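import Literature.IUT.HodgeArakelov.EtaleThetaDataOfSettingRootHypOfCor28iIntrinsicStable
import Literature.IUT.HodgeArakelov.ThetaEnvDataRecordAutSaturatedOfCor28iIntrinsic

/-!
# G-w5d169-2: the binder «`Γ` stabilises `ι(toTheta⁻¹Δ_Θ)` and `ι(Ker toTheta)`» FROM «`γ(Δ^tp_X) = Δ^tp_X`»

S. Mochizuki, *The étale theta function …*, Publ. RIMS **45** (2009) [EtTh] (refereed), Cor. 2.8 (i) p. 42, proof
l. 3–5: "since `Δ_Θ ⊆ (Δ^tp_X)^Θ` may be characterized as a subquotient of `Π^tp_C` … `γ` induces an automorphism of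
`Δ_Θ`"; Thm. 1.6 (ii) p. 24 (the theta companion of an automorphism of `Π^tp_X`); [AbsAnab] Lem. 1.3.8 shape
«`γ(Δ^tp_X) = Δ^tp_X`» [cite: MochizukiEtTh2009, Cor 2.8(i) p.42].  [IUTchII] Prop. 1.4 p. 27 / Prop. 3.4 (i) p. 91
(claim key `Mochizuki2012`, DISPUTED, D-0012) [cite: Mochizuki2012, Prop 1.4 p.27].

abc-iut cell (block C / W6 seat abc-iut-w6-d002 gen 7; GAP-LEDGER row **G-w5d169-2**, scoped by this base gen 2).
PROOF-ONLY (0 def, no instance, no named fact, nothing restated).  The two supplier routes of record for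
abc-iut-w5-d169's binder `hroot` carry DIFFERENT currencies for the clause «`γ` induces an automorphism of `Δ_Θ`»:
* ROUTE 2 (abc-iut-w5-d118, `rootHyp_of_cor28_i`, p445404): binders `hιX : range ι = Π^tp_X` of `T` and
  `hΔ : ∀ γ ∈ Aut_top(Π^tp_X), γ(Δ^tp_X) = Δ^tp_X` (+ `hq`), through abc-iut-w5-d072's CONSTRUCTED theta companion
  `ThetaSetting.thetaCompanionOfAut` and abc-iut-w5-d118's `OrbitEmbedding.exists_inducesOnTheta_of_companion`;
* COMPANION-FREE route (abc-iut-w6-d051, `rootHyp_of_cor28_i_intrinsic(_innerAdjust/_stable)`, p445736 / p446492 /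
  p448326): binder `hInd : ∀ tower-stabilising Γ ∃ Γ_Θ, InducesOnTheta Γ Γ_Θ`, equivalently (p448326) `hΘ : ∀
  tower-stabilising Γ, Γ(ε.top) = ε.top ∧ Γ(ε.bot) = ε.bot` — whose docstrings RECORD (prose only) that `hInd` follows
  from `hιX + hΔ`.
HERE that prose becomes kernel-checked: **`exists_inducesOnTheta_of_deltaPreserving`** /
**`top_bot_map_eq_of_deltaPreserving`** — for every tower-stabilising `Γ ∈ Aut_top(Π^tp_C)`, (`hιe`, `hιX`, `hq`, `hΔ`) ⟹
`∃ Γ_Θ, InducesOnTheta Γ Γ_Θ` and `Γ(ε.top) = ε.top ∧ Γ(ε.bot) = ε.bot` (restrict `Γ` to `range ι = Π^tp_X` —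
`exists_restrict_aut`; companion `thetaCompanionOfAut γ (hΔ γ) hq`; `exists_inducesOnTheta_of_companion`;
`InducesOnTheta.map_top_eq / map_bot_eq`) — and the closer **`rootHyp_of_cor28_i_stable_of_deltaPreserving`** =
p448326's `rootHyp_of_cor28_i_intrinsic_stable` with `hΘ` DISCHARGED from {`hιX`, `hΔ`, `hq`}: residual BY NAME
{F-0609 `h24`, F-0640 `h28`, `hstd`, `hDtau'` (inner-adjusted), `hιe`, `hιX`, `hΔ`, `hq`} — ROUTE 2's list (p445404)
with the un-adjusted `hDtau` replaced by the inner-adjusted `hDtau'`, so the two routes' residuals are now comparable in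
the kernel.  Nothing of [IUTchII] asserted; no side taken on [IUTchIII] Cor. 3.12; typed ≠ proved.
-/

noncomputable section

open Topology

namespace Literature.IUT.HodgeArakelov

namespace EtaleThetaDataOfSetting

open Literature.AnabelianGeometry.EtaleTheta ThetaCovers
open Literature.AnabelianGeometry.EtaleTheta CohomologySystemOfContH1

universe u

variable {p : ℕ} [Fact p.Prime] {D : Literature.AnabelianGeometry.EtaleTheta.ThetaSetting p}
  {E : D.EtaleThetaData} {l : ℕ}

/-! ### Tower-stabilising automorphisms of `Π^tp_C` restrict to `Π^tp_X` and induce on `Δ_Θ` -/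

section Induce

variable (C : E.DoubleUnderline l) {T : TemperedCoverData.{u} l} (ε : C.OrbitEmbedding T)

/-- **Restriction to `Π^tp_X` of a tower-stabilising `Γ ∈ Aut_top(Π^tp_C)`**: `Π^tp_X` of `T` (`T.tp T.PiX`) is a member of
the Prop 2.4 tower, so `Γ(range ι) = range ι` and `Γ` restricts along the open embedding `ι` to some
`γ ∈ Aut_top(Π^tp_X)` with `ι ∘ γ = Γ ∘ ι` (abc-iut-w5-d118's `exists_restrict_aut`). [cite: MochizukiEtTh2009, Prop 2.4 p.38] -/
theorem exists_restrict_aut_of_tower (hιe : IsOpenEmbedding ε.ι) (hιX : ε.ι.range = T.tp T.PiX)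
    (Γ : T.Gtp ≃ₜ* T.Gtp) (hΓ : ∀ S ∈ T.tower, S.map Γ.toMulEquiv.toMonoidHom = S) :
    ∃ γ : D.PiTemp ≃ₜ* D.PiTemp, ∀ g, ε.ι (γ g) = Γ (ε.ι g) :=
  exists_restrict_aut C ε hιe hιX Γ (hΓ _ (by simp [TemperedCoverData.tower]))

/-- **«`γ` induces an automorphism of `Δ_Θ`» from «`γ(Δ^tp_X) = Δ^tp_X`»**: for every tower-stabilising
`Γ ∈ Aut_top(Π^tp_C)`, granted `range ι = Π^tp_X` of `T` (`hιX`, `ι` an open embedding `hιe`), `toTheta` a topological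
quotient map (`hq`) and `γ(Δ^tp_X) = Δ^tp_X` for every `γ ∈ Aut_top(Π^tp_X)` (`hΔ`), there is `Γ_Θ` INDUCED by `Γ` on the
cyclotome `top/bot` of `ofEmbedding ε hC hS`: restrict `Γ` to `γ` (`exists_restrict_aut_of_tower`), take abc-iut-w5-d072's
constructed theta companion `thetaCompanionOfAut γ (hΔ γ) hq` (Thm 1.6 (ii)), and apply abc-iut-w5-d118's
`exists_inducesOnTheta_of_companion`.  This is the binder `hInd` of p445736 / p446492 / p447525.
[cite: MochizukiEtTh2009, Cor 2.8(i) p.42] -/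
theorem exists_inducesOnTheta_of_deltaPreserving (hιe : IsOpenEmbedding ε.ι) (hιX : ε.ι.range = T.tp T.PiX)
    (hq : IsQuotientMap D.toTheta) (hC : D.Compat) (hS : D.Sec2Hyps)
    (hΔ : ∀ γ : D.PiTemp ≃ₜ* D.PiTemp, D.DeltaTemp.map γ.toMulEquiv.toMonoidHom = D.DeltaTemp)
    (Γ : T.Gtp ≃ₜ* T.Gtp) (hΓ : ∀ S ∈ T.tower, S.map Γ.toMulEquiv.toMonoidHom = S) :
    ∃ ΓΘ : (ThetaOrbitData.ofEmbedding ε hC hS).DeltaTheta ≃* (ThetaOrbitData.ofEmbedding ε hC hS).DeltaTheta,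
      (ThetaOrbitData.ofEmbedding ε hC hS).InducesOnTheta Γ ΓΘ := by
  obtain ⟨γ, hγ⟩ := exists_restrict_aut_of_tower C ε hιe hιX Γ hΓ
  obtain ⟨ΓΘ, hind, -⟩ := ε.exists_inducesOnTheta_of_companion hC hS hγ (D.thetaCompanionOfAut γ (hΔ γ) hq)
  exact ⟨ΓΘ, hind⟩

/-- **«`Δ_Θ` is a characteristic subquotient» in subgroup-stability currency, from «`γ(Δ^tp_X) = Δ^tp_X`»**: every
tower-stabilising `Γ ∈ Aut_top(Π^tp_C)` stabilises `ε.top = ι(toTheta⁻¹Δ_Θ)` and `ε.bot = ι(Ker toTheta)` — the binder `hΘ` of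
abc-iut-w6-d051's `rootHyp_of_cor28_i_intrinsic_stable` (p448326) — granted `hιe`, `hιX`, `hq`, `hΔ`
(`exists_inducesOnTheta_of_deltaPreserving` + `InducesOnTheta.map_top_eq / map_bot_eq`).
[cite: MochizukiEtTh2009, Cor 2.8(i) p.42] -/
theorem top_bot_map_eq_of_deltaPreserving (hιe : IsOpenEmbedding ε.ι) (hιX : ε.ι.range = T.tp T.PiX)
    (hq : IsQuotientMap D.toTheta) (hC : D.Compat) (hS : D.Sec2Hyps)
    (hΔ : ∀ γ : D.PiTemp ≃ₜ* D.PiTemp, D.DeltaTemp.map γ.toMulEquiv.toMonoidHom = D.DeltaTemp)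
    (Γ : T.Gtp ≃ₜ* T.Gtp) (hΓ : ∀ S ∈ T.tower, S.map Γ.toMulEquiv.toMonoidHom = S) :
    ε.top.map Γ.toMulEquiv.toMonoidHom = ε.top ∧ ε.bot.map Γ.toMulEquiv.toMonoidHom = ε.bot := by
  obtain ⟨ΓΘ, hind⟩ := exists_inducesOnTheta_of_deltaPreserving C ε hιe hιX hq hC hS hΔ Γ hΓ
  exact ⟨hind.map_top_eq, hind.map_bot_eq⟩

/-- **The same for `top` alone, WITHOUT `hC`/`hS`**: `Γ(ε.top) = ε.top` directly from the theta companion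
(abc-iut-w5-d118's `map_top_eq_of_companion`). [cite: MochizukiEtTh2009, Cor 2.8(i) p.42] -/
theorem top_map_eq_of_deltaPreserving (hιe : IsOpenEmbedding ε.ι) (hιX : ε.ι.range = T.tp T.PiX)
    (hq : IsQuotientMap D.toTheta)
    (hΔ : ∀ γ : D.PiTemp ≃ₜ* D.PiTemp, D.DeltaTemp.map γ.toMulEquiv.toMonoidHom = D.DeltaTemp)
    (Γ : T.Gtp ≃ₜ* T.Gtp) (hΓ : ∀ S ∈ T.tower, S.map Γ.toMulEquiv.toMonoidHom = S) :
    ε.top.map Γ.toMulEquiv.toMonoidHom = ε.top := by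
  obtain ⟨γ, hγ⟩ := exists_restrict_aut_of_tower C ε hιe hιX Γ hΓ
  exact ε.map_top_eq_of_companion hγ (D.thetaCompanionOfAut γ (hΔ γ) hq)

end Induce

/-! ### The closer: p448326 with `hΘ` discharged from `hιX + hΔ + hq` -/

section Root

variable (C : E.DoubleUnderline l) (hq : IsQuotientMap D.toTheta) (α : (Pi C) ≃ₜ* (Pi C))
  {T : TemperedCoverData.{u} l} (ε : C.OrbitEmbedding T)

/-- **G-w5d169-2 ALONG ROUTE 2, COMPANION-FREE CLOSER WITH `hΘ` DISCHARGED**: abc-iut-w5-d169's `hroot` — «every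
topological automorphism `α` of `Π^tp_X̲̲` carries `η̲̈^Θ ∈ H¹(Π^tp_Ÿ̲̲, l·Δ_Θ)` to a `Π^tp_X̲̲`-conjugate up to an `l`-torsion
class» — as abc-iut-w6-d051's `rootHyp_of_cor28_i_intrinsic_stable` (p448326) with its binder `hΘ` SUPPLIED by
`top_bot_map_eq_of_deltaPreserving`.  Residual BY NAME: {F-0609 `h24`, F-0640 `h28`, `hstd`, `hDtau'` (inner-adjusted,
abc-iut-w5-d118's v2-A shape), `hιe`, `hιX`, `hΔ`, `hq`} — ROUTE 2's list (p445404 `rootHyp_of_cor28_i`) with `hDtau`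
replaced by the weaker inner-adjusted `hDtau'`. [cite: MochizukiEtTh2009, Cor 2.8(i) p.42] -/
theorem rootHyp_of_cor28_i_stable_of_deltaPreserving [(PiYdd C).Normal] [hN : D.GtpYdd.Normal] {N : ℕ+}
    (μ : D.CyclotomeMod l N) (hC : D.Compat) (hS : D.Sec2Hyps) (h15 : D.Prop15iii E hC) (L : C.CuspLabels)
    (R : RigidData.{0} N l) (hR : R = C.rigidData μ hC hS h15 L) (h218i : R.Cor218_i)
    (hιe : IsOpenEmbedding ε.ι) (hιX : ε.ι.range = T.tp T.PiX)
    (hΔ : ∀ γ : D.PiTemp ≃ₜ* D.PiTemp, D.DeltaTemp.map γ.toMulEquiv.toMonoidHom = D.DeltaTemp)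
    (h24 : T.Prop24)
    (hstd : (ThetaOrbitData.ofEmbedding ε hC hS).IsStandard) (h28 : (ThetaOrbitData.ofEmbedding ε hC hS).Cor28_i)
    (hDtau' : ∀ Γ : T.Gtp ≃ₜ* T.Gtp, (∀ S ∈ T.tower, S.map Γ.toMulEquiv.toMonoidHom = S) →
      ∃ u ∈ C.Huu, ∀ Dt ∈ (ThetaOrbitData.ofEmbedding ε hC hS).Dtau,
        Dt.map (Γ.trans (ThetaOrbitData.innerAutTop (ε.ι u))).toMulEquiv.toMonoidHom ∈
          (ThetaOrbitData.ofEmbedding ε hC hS).Dtau) :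
    ∃ τ : Pi C, ∃ ε' : (coh C).H1 ⊤, l • ε' = 0 ∧
      autActTopOfCor218i C hq μ hC hS h15 L R hR h218i α (rootTop C) =
        h1TopConjEquiv (phi C) (D.lDeltaTheta l) (PiYdd C) τ (rootTop C) + ε' :=
  rootHyp_of_cor28_i_intrinsic_stable C hq α ε μ hC hS h15 L R hR h218i hιe h24 hstd h28 hDtau'
    fun Γ hΓ => top_bot_map_eq_of_deltaPreserving C ε hιe hιX hq hC hS hΔ Γ hΓ

/-- **The same through the `hInd` door** (p446492 `rootHyp_of_cor28_i_intrinsic_innerAdjust`, `hInd` SUPPLIED by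
`exists_inducesOnTheta_of_deltaPreserving`) — definitionally the same residual; recorded so that consumers of either
abc-iut-w6-d051 closer can switch currencies by name. [cite: MochizukiEtTh2009, Cor 2.8(i) p.42] -/
theorem rootHyp_of_cor28_i_innerAdjust_of_deltaPreserving [(PiYdd C).Normal] [hN : D.GtpYdd.Normal] {N : ℕ+}
    (μ : D.CyclotomeMod l N) (hC : D.Compat) (hS : D.Sec2Hyps) (h15 : D.Prop15iii E hC) (L : C.CuspLabels)
    (R : RigidData.{0} N l) (hR : R = C.rigidData μ hC hS h15 L) (h218i : R.Cor218_i)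
    (hιe : IsOpenEmbedding ε.ι) (hιX : ε.ι.range = T.tp T.PiX)
    (hΔ : ∀ γ : D.PiTemp ≃ₜ* D.PiTemp, D.DeltaTemp.map γ.toMulEquiv.toMonoidHom = D.DeltaTemp)
    (h24 : T.Prop24)
    (hstd : (ThetaOrbitData.ofEmbedding ε hC hS).IsStandard) (h28 : (ThetaOrbitData.ofEmbedding ε hC hS).Cor28_i)
    (hDtau' : ∀ Γ : T.Gtp ≃ₜ* T.Gtp, (∀ S ∈ T.tower, S.map Γ.toMulEquiv.toMonoidHom = S) →
      ∃ u ∈ C.Huu, ∀ Dt ∈ (ThetaOrbitData.ofEmbedding ε hC hS).Dtau,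
        Dt.map (Γ.trans (ThetaOrbitData.innerAutTop (ε.ι u))).toMulEquiv.toMonoidHom ∈
          (ThetaOrbitData.ofEmbedding ε hC hS).Dtau) :
    ∃ τ : Pi C, ∃ ε' : (coh C).H1 ⊤, l • ε' = 0 ∧
      autActTopOfCor218i C hq μ hC hS h15 L R hR h218i α (rootTop C) =
        h1TopConjEquiv (phi C) (D.lDeltaTheta l) (PiYdd C) τ (rootTop C) + ε' :=
  rootHyp_of_cor28_i_intrinsic_innerAdjust C hq α ε μ hC hS h15 L R hR h218i hιe h24 hstd h28 hDtau'
    fun Γ hΓ => exists_inducesOnTheta_of_deltaPreserving C ε hιe hιX hq hC hS hΔ Γ hΓ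

end Root

end EtaleThetaDataOfSetting

/-! ### The node statement [IUTchII] Prop 3.4 (i) in the same currency -/

namespace EtaleLevels

open Literature.AnabelianGeometry.EtaleTheta Literature.AnabelianGeometry.SemiGraphs
open CohomologySystemOfContH1 EtaleThetaDataOfSetting TemperedThetaMonoids ThetaCovers
open scoped Literature.AnabelianGeometry.EtaleTheta

universe u

variable {p : ℕ} [Fact p.Prime] {D : Literature.AnabelianGeometry.EtaleTheta.ThetaSetting p}
  {E : D.EtaleThetaData} {l : ℕ} (C : E.DoubleUnderline l) (hC : D.Compat) (hS : D.Sec2Hyps)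
  (hl : l.Prime) (hp2 : p ≠ 2) (hpl : p ≠ l) (hζ : ∃ ζ : D.K, IsPrimitiveRoot ζ (4 * l))
  (mods : ∀ M : ℕ+, D.CyclotomeMod l M)
  (f : contCocycles D.toTheta D.DeltaTheta C.GtpYdduu) (hf : f ∈ C.rootCocycles hC)
  (hmods : ∀ (M M' : ℕ+) (h : (M : ℕ) ∣ (M' : ℕ)) (x : D.lDeltaTheta l),
    MuN.red p M M' h ((mods M').red x) = (mods M).red x)
  (h15 : Literature.AnabelianGeometry.EtaleTheta.ThetaSetting.Prop15iii E hC) (L : C.CuspLabels)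
  (hZ : ∀ M : ℕ+, Nonempty (ModelCyclotomes.lDeltaQuot (C.rigidData (mods M) hC hS h15 L) ≃*
    Literature.IUT.HodgeTheaters.ZHat))
  (hlim : Function.Bijective (rigidLimHom C hC hS hl hp2 hpl hζ mods f hf hmods h15 L hZ))
  [(EtaleThetaDataOfSetting.PiYdd C).Normal]
  (hq : IsQuotientMap D.toTheta) {N : ℕ+} (μ : D.CyclotomeMod l N)
  (R : RigidData.{0} N l) (hR : R = C.rigidData μ hC hS h15 L) (h218i : R.Cor218_i)
  -- ROUTE 2, COMPANION-FREE inputs as in p447525, EXCEPT `hInd`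
  {T : TemperedCoverData.{u} l} (ε : C.OrbitEmbedding T)
  (hιe : IsOpenEmbedding ε.ι) (h24 : T.Prop24) (hstd : (ThetaOrbitData.ofEmbedding ε hC hS).IsStandard)
  (h28 : (ThetaOrbitData.ofEmbedding ε hC hS).Cor28_i)
  (hDtau' : ∀ Γ : T.Gtp ≃ₜ* T.Gtp, (∀ S ∈ T.tower, S.map Γ.toMulEquiv.toMonoidHom = S) →
    ∃ u ∈ C.Huu, ∀ Dt ∈ (ThetaOrbitData.ofEmbedding ε hC hS).Dtau,
      Dt.map (Γ.trans (ThetaOrbitData.innerAutTop (ε.ι u))).toMulEquiv.toMonoidHom ∈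
        (ThetaOrbitData.ofEmbedding ε hC hS).Dtau)
  -- `hInd` REPLACED by ROUTE 2's `hιX` + `hΔ` (this file's `exists_inducesOnTheta_of_deltaPreserving`)
  (hιX : ε.ι.range = T.tp T.PiX)
  (hΔ : ∀ γ : D.PiTemp ≃ₜ* D.PiTemp, D.DeltaTemp.map γ.toMulEquiv.toMonoidHom = D.DeltaTemp)
  -- index / constants / origin / (P3)
  (ι₀ : (Pi C) ≃ₜ* (Pi C))
  {Es : Set ℕ+} (τw : D.CyclotomeTower l Es)
  (O : Submonoid (PadicAlgCl p)ˣ)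
  (hO : ∀ (σ : GQp p) (u : (PadicAlgCl p)ˣ), u ∈ O → Units.map (σ : PadicAlgCl p →* PadicAlgCl p) u ∈ O)
  (hO' : D.IsEtThOrigin)
  (hgal : ∀ α : (Pi C) ≃ₜ* (Pi C), ∃ τ : GQp p,
    (∀ x : Pi C, aug C (α x) = τ * aug C x * τ⁻¹) ∧
    (∀ (M : ℕ+) (z w : D.lDeltaTheta l),
      ((rangeAutOfCor218i C μ hq hC hS h15 L R hR h218i α
          ⟨(z : D.GtpTheta), lDeltaTheta_le_phiRange C z.2⟩ : phiRange C) : D.GtpTheta) = (w : D.GtpTheta) →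
        (τw.modAll M).red w = galMuN p M τ ((τw.modAll M).red z)))

/-- **[IUTchII] Prop 3.4 (i) — MULTIRADIALITY OF SPLIT THETA MONOIDS AT THE GENUINE FUNCTOR, root binder along
ROUTE 2, COMPANION-FREE, `hInd` DISCHARGED from `hιX + hΔ`**: abc-iut-w6-d051's
`prop34i_multiradiallyDefined_saturated_ofCor28iIntrinsic` (p447525) with (P4) := `hroot` FROM F-0609 (`h24`) + F-0640
(`h28`, `hstd`, `hDtau'` inner-adjusted) along `ε` (`hιe`, `hιX`) and «`γ(Δ^tp_X) = Δ^tp_X`» (`hΔ`); (P1) := {F-0620, `hq`};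
(P3) := `hgal`.  Residual BY NAME = p447525's with `hInd` ↦ {`hιX`, `hΔ`} = p444361's (ROUTE 2 v2) with `hDtau` ↦
`hDtau'`. [cite: Mochizuki2012, Prop 3.4 (i) p.92] -/
theorem prop34i_multiradiallyDefined_saturated_ofCor28iStableOfDelta
    (c : CyclotomeCoefficients (phi C) (D.lDeltaTheta l) (PadicAlgCl p)ˣ)
    (hlev : ∀ (ζ : cyclotome (PadicAlgCl p)ˣ) (M : ℕ+),
      (((τw.modAll M).red (c.hom ζ) : MuN p M) : (PadicAlgCl p)ˣ) = (ζ : ℕ+ → (PadicAlgCl p)ˣ) M)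
    {η : (C.thetaEnvData μ hC hS).PiYdd → MuN p N} (hη : η ∈ (C.thetaEnvData μ hC hS).thetaCocycles)
    (Γ : Type) [Group Γ] :
    haveI := hC.GtpYdd_normal
    ((ex18iii (ThetaSetting.ofDoubleUnderline C μ hC hS hl hp2 hpl hζ hη) Γ).toDagger
      (TemperedThetaMonoids.prop34iRadialFunctor
        (thetaEnvTransportS C hC hS hl hp2 hpl hζ mods f hf hmods h15 L hZ
          (piYddCharacteristic_of_cor218_i C μ hC hS h15 L R hR h218i) hlim hq μ R hR h218i
          (h1LimKummerOn (phi C) (D.lDeltaTheta l) (PiYdd C) c (isOpen_stabilizer_units C)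
            (finiteIndex_stabilizer_units C) O) ι₀
          (map_mrange_h1LimKummerOn_eq_of_galois C hq μ τw c hlev O hO hC hS h15 L R hR h218i hO' hgal)
          (image_toLim_theta_thetaEnvData_of_rootHyp C hC hS hl hp2 hpl hζ mods f hf hmods h15 L hZ
          (piYddCharacteristic_of_cor218_i C μ hC hS h15 L R hR h218i) hlim hq
            μ R hR h218i
            (fun α => rootHyp_of_cor28_i_innerAdjust_of_deltaPreserving C hq α ε μ hC hS h15 L R hR h218i hιe hιX hΔ
              h24 hstd h28 hDtau'))
          (image_thetaInfty_thetaEnvData_of_rootHyp C hC hS hl hp2 hpl hζ mods f hf hmods h15 L hZ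
          (piYddCharacteristic_of_cor218_i C μ hC hS h15 L R hR h218i) hlim hq μ
            R hR h218i
            (fun α => rootHyp_of_cor28_i_innerAdjust_of_deltaPreserving C hq α ε μ hC hS h15 L R hR h218i hιe hιX hΔ
              h24 hstd h28 hDtau')) hη)
        Γ)).IsMultiradiallyDefined := by
  haveI := hC.GtpYdd_normal
  exact prop34i_multiradiallyDefined_saturated_ofCor28iIntrinsic C hC hS hl hp2 hpl hζ mods f hf hmods h15 L hZ hlim hq μ
    R hR h218i ε hιe h24 hstd h28 hDtau'
    (fun Γ hΓ => exists_inducesOnTheta_of_deltaPreserving C ε hιe hιX hq hC hS hΔ Γ hΓ) ι₀ τw O hO hO' hgal c hlev hη Γ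

/-- **The same with the coefficient datum DISCHARGED** (as p447525's `exists_coeff_…_ofCor28iIntrinsic`, under `hO'` +
`hΔc`): residual BY NAME {F-0620, F-0609, F-0640, `hq`, `hO'`, `hΔc`, `hιe`, `hιX`, `hΔ`, `hstd`, `hDtau'`, `hgal`} plus
the standing record/tower inputs. [cite: Mochizuki2012, Prop 3.4 (i) p.92] -/
theorem exists_coeff_prop34i_multiradiallyDefined_saturated_ofCor28iStableOfDelta
    (hΔc : IsCompact (D.DeltaTheta : Set D.GtpTheta))
    {η : (C.thetaEnvData μ hC hS).PiYdd → MuN p N} (hη : η ∈ (C.thetaEnvData μ hC hS).thetaCocycles)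
    (Γ : Type) [Group Γ] :
    haveI := hC.GtpYdd_normal
    ∃ (c : CyclotomeCoefficients (phi C) (D.lDeltaTheta l) (PadicAlgCl p)ˣ)
      (hlev : ∀ (ζ : cyclotome (PadicAlgCl p)ˣ) (M : ℕ+),
        (((τw.modAll M).red (c.hom ζ) : MuN p M) : (PadicAlgCl p)ˣ) = (ζ : ℕ+ → (PadicAlgCl p)ˣ) M),
      Function.Bijective c.hom ∧
      ((ex18iii (ThetaSetting.ofDoubleUnderline C μ hC hS hl hp2 hpl hζ hη) Γ).toDagger
        (TemperedThetaMonoids.prop34iRadialFunctor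
          (thetaEnvTransportS C hC hS hl hp2 hpl hζ mods f hf hmods h15 L hZ
          (piYddCharacteristic_of_cor218_i C μ hC hS h15 L R hR h218i) hlim hq μ R hR h218i
            (h1LimKummerOn (phi C) (D.lDeltaTheta l) (PiYdd C) c (isOpen_stabilizer_units C)
              (finiteIndex_stabilizer_units C) O) ι₀
            (map_mrange_h1LimKummerOn_eq_of_galois C hq μ τw c hlev O hO hC hS h15 L R hR h218i hO' hgal)
            (image_toLim_theta_thetaEnvData_of_rootHyp C hC hS hl hp2 hpl hζ mods f hf hmods h15 L hZ
          (piYddCharacteristic_of_cor218_i C μ hC hS h15 L R hR h218i) hlim hq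
              μ R hR h218i
              (fun α => rootHyp_of_cor28_i_innerAdjust_of_deltaPreserving C hq α ε μ hC hS h15 L R hR h218i hιe hιX hΔ
              h24 hstd h28 hDtau'))
            (image_thetaInfty_thetaEnvData_of_rootHyp C hC hS hl hp2 hpl hζ mods f hf hmods h15 L hZ
          (piYddCharacteristic_of_cor218_i C μ hC hS h15 L R hR h218i) hlim hq
              μ R hR h218i
              (fun α => rootHyp_of_cor28_i_innerAdjust_of_deltaPreserving C hq α ε μ hC hS h15 L R hR h218i hιe hιX hΔ
              h24 hstd h28 hDtau')) hη)
          Γ)).IsMultiradiallyDefined := by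
  haveI := hC.GtpYdd_normal
  exact exists_coeff_prop34i_multiradiallyDefined_saturated_ofCor28iIntrinsic C hC hS hl hp2 hpl hζ mods f hf hmods h15 L
    hZ hlim hq μ R hR h218i ε hιe h24 hstd h28 hDtau'
    (fun Γ hΓ => exists_inducesOnTheta_of_deltaPreserving C ε hιe hιX hq hC hS hΔ Γ hΓ) ι₀ τw O hO hO' hgal hΔc hη Γ

end EtaleLevels

end Literature.IUT.HodgeArakelov

end
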